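import Mathlib
import Summits.Ventures.Crystal3D.Theorems.StickyWulffConstantTextureLiminfTentPlanes
import Summits.Ventures.Crystal3D.Theorems.StickyWulffConstantTextureLiminfTexShadowDefs
import HarnessLib

/-!
# The tent certificate for fcc grains — the super-level set as a union of open polytope pieces (eng g8)

Route `StickyWulffConstant` (`Summits/Ventures/Crystal3D`, cell `crystal3d-full`), support toward the crux
`TextureLiminf` (stmt-Ventures-19483), FREE half (tent certificate, TexShadow v6.1), the POLYTOPE clause of
`BarlowFreeCertificate` in the cubic frame: at a generic level `t` the super-level set `{f_X > t}` is, up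
to a null set (cell boundaries), the disjoint union of the open convex pieces `cell ∩ {affine > t}`, each
an open H-polytope (`TexShadow.polytope`) with UNIT normals and pairwise DISTINCT facet planes, inside its
cell (hence inside one bilayer slab).
* unit-normal H-data with the same polytope and planes (`polytope_image_normalize`, …);
* `exists_polytope_pieces` — the packaged clause, consumed by `…TentCertificate.lean`.
WHAT THIS IS NOT: the certificate; F-C1 not moved.
-/

noncomputable section

namespace Summit.Ventures.Crystal3D.TentCertificate

open Finset Summit.Ventures.Crystal3D MeasureTheory
open Literature.Geometry.DiscreteGeometry (intVec intVec_apply)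
open Summit.Ventures.Crystal3D.Cruxes.TextureLiminf.TexShadow (polytope)
open scoped RealInnerProductSpace

/-- Open chambers are convex (copy for this file). -/
theorem convex_cellOf' (k : Fin 3 → ℤ) (m : Fin 4 → ℤ) : Convex ℝ (cellOf k m) := by
  unfold cellOf
  refine convex_iInter₂ fun q _ => ?_
  have hlin : IsLinearMap ℝ (fun x : EuclideanSpace ℝ (Fin 3) => ⟪q.1, x⟫) :=
    ⟨fun x y => inner_add_right _ _ _, fun c x => by rw [real_inner_smul_right, smul_eq_mul]⟩
  exact convex_halfSpace_lt hlin q.2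

/-! ## Unit-normal data, open chambers, the empty piece -/

/-- Chambers are open. -/
theorem isOpen_cellOf (k : Fin 3 → ℤ) (m : Fin 4 → ℤ) : IsOpen (cellOf k m) :=
  isOpen_biInter_finset fun _ _ => isOpen_lt (continuous_const.inner continuous_id) continuous_const

/-- The normals of `chamberH` are nonzero. -/
theorem chamberH_fst_ne_zero {k : Fin 3 → ℤ} {m : Fin 4 → ℤ} {q : EuclideanSpace ℝ (Fin 3) × ℝ}
    (hq : q ∈ chamberH k m) : q.1 ≠ 0 := by
  obtain ⟨σ, n, hσ, hq1, hq2⟩ := chamberH_fst_eq hq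
  rw [hq1]; intro h
  rw [smul_eq_zero] at h
  rcases h with h | h
  · have hs : Real.sqrt 2 ≠ 0 := by positivity
    rcases hσ with rfl | rfl <;> simp [hs] at h
  · rcases hq2 with ⟨i, rfl, -⟩ | ⟨j, rfl, -⟩
    · have := congrArg (fun v : EuclideanSpace ℝ (Fin 3) => v i) h; simp [intVec_apply] at this
    · have := congrArg (fun v : EuclideanSpace ℝ (Fin 3) => v 0) h
      fin_cases j <;> simp [intVec_apply, normal4] at this

/-- Normalising H-data with nonzero normals keeps the polytope. -/
theorem polytope_image_normalize (H : Finset (EuclideanSpace ℝ (Fin 3) × ℝ)) (h0 : ∀ p ∈ H, p.1 ≠ 0) :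
    polytope (H.image fun p => (‖p.1‖⁻¹ • p.1, ‖p.1‖⁻¹ * p.2)) = polytope H := by
  simp only [polytope, Finset.set_biInter_finset_image]
  refine Set.iInter₂_congr fun p hp => ?_
  exact halfSpace_smul_eq (inv_pos.2 (norm_pos_iff.2 (h0 p hp)))

/-- Normalised data have unit normals. -/
theorem norm_fst_of_mem_image_normalize {H : Finset (EuclideanSpace ℝ (Fin 3) × ℝ)} (h0 : ∀ p ∈ H, p.1 ≠ 0)
    {p' : EuclideanSpace ℝ (Fin 3) × ℝ} (hp' : p' ∈ H.image fun p => (‖p.1‖⁻¹ • p.1, ‖p.1‖⁻¹ * p.2)) :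
    ‖p'.1‖ = 1 := by
  obtain ⟨p, hp, rfl⟩ := Finset.mem_image.1 hp'
  simp only [norm_smul, norm_inv, norm_norm]
  exact inv_mul_cancel₀ (norm_ne_zero_iff.2 (h0 p hp))

/-- Normalising keeps facet planes, hence their pairwise distinctness. -/
theorem plane_ne_of_mem_image_normalize {H : Finset (EuclideanSpace ℝ (Fin 3) × ℝ)} (h0 : ∀ p ∈ H, p.1 ≠ 0)
    (hH : ∀ p ∈ H, ∀ q ∈ H, p ≠ q → {x : EuclideanSpace ℝ (Fin 3) | ⟪p.1, x⟫ = p.2} ≠ {x | ⟪q.1, x⟫ = q.2})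
    {p' q' : EuclideanSpace ℝ (Fin 3) × ℝ} (hp' : p' ∈ H.image fun p => (‖p.1‖⁻¹ • p.1, ‖p.1‖⁻¹ * p.2))
    (hq' : q' ∈ H.image fun p => (‖p.1‖⁻¹ • p.1, ‖p.1‖⁻¹ * p.2)) (hne : p' ≠ q') :
    {x : EuclideanSpace ℝ (Fin 3) | ⟪p'.1, x⟫ = p'.2} ≠ {x | ⟪q'.1, x⟫ = q'.2} := by
  obtain ⟨p, hp, rfl⟩ := Finset.mem_image.1 hp'
  obtain ⟨q, hq, rfl⟩ := Finset.mem_image.1 hq'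
  have hpq : p ≠ q := fun h => hne (by rw [h])
  simp only
  rw [plane_smul_eq (inv_ne_zero (norm_ne_zero_iff.2 (h0 p hp))),
    plane_smul_eq (inv_ne_zero (norm_ne_zero_iff.2 (h0 q hq)))]
  exact hH p hp q hq hpq

/-- The standard EMPTY piece `{x₀ < 0} ∩ {x₀ > 1}` with unit normals and distinct planes. -/
theorem emptyPiece_spec :
    polytope ({(EuclideanSpace.single (0 : Fin 3) (1 : ℝ), (0 : ℝ)),
        (-EuclideanSpace.single (0 : Fin 3) (1 : ℝ), (-1 : ℝ))} : Finset (EuclideanSpace ℝ (Fin 3) × ℝ)) = ∅ ∧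
    (∀ p ∈ ({(EuclideanSpace.single (0 : Fin 3) (1 : ℝ), (0 : ℝ)),
        (-EuclideanSpace.single (0 : Fin 3) (1 : ℝ), (-1 : ℝ))} : Finset (EuclideanSpace ℝ (Fin 3) × ℝ)), ‖p.1‖ = 1) ∧
    (∀ p ∈ ({(EuclideanSpace.single (0 : Fin 3) (1 : ℝ), (0 : ℝ)),
        (-EuclideanSpace.single (0 : Fin 3) (1 : ℝ), (-1 : ℝ))} : Finset (EuclideanSpace ℝ (Fin 3) × ℝ)),
      ∀ p' ∈ ({(EuclideanSpace.single (0 : Fin 3) (1 : ℝ), (0 : ℝ)),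
        (-EuclideanSpace.single (0 : Fin 3) (1 : ℝ), (-1 : ℝ))} : Finset (EuclideanSpace ℝ (Fin 3) × ℝ)),
      p ≠ p' → {x : EuclideanSpace ℝ (Fin 3) | ⟪p.1, x⟫ = p.2} ≠ {x | ⟪p'.1, x⟫ = p'.2}) := by
  have hin : ∀ x : EuclideanSpace ℝ (Fin 3), ⟪EuclideanSpace.single (0 : Fin 3) (1 : ℝ), x⟫ = x 0 := by
    intro x; rw [EuclideanSpace.inner_single_left]; simp
  refine ⟨?_, ?_, ?_⟩
  · ext x
    simp only [polytope, Finset.set_biInter_insert, Finset.set_biInter_singleton, Set.mem_inter_iff,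
      Set.mem_setOf_eq, Set.mem_empty_iff_false, iff_false, not_and, inner_neg_left, hin]
    intro h1 h2; linarith
  · intro p hp
    simp only [Finset.mem_insert, Finset.mem_singleton] at hp
    rcases hp with rfl | rfl <;> simp [norm_neg]
  · intro p hp p' hp' hne
    simp only [Finset.mem_insert, Finset.mem_singleton] at hp hp'
    have key : {x : EuclideanSpace ℝ (Fin 3) | ⟪EuclideanSpace.single (0 : Fin 3) (1 : ℝ), x⟫ = 0} ≠
        {x | ⟪-EuclideanSpace.single (0 : Fin 3) (1 : ℝ), x⟫ = -1} := by
      intro h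
      have : (0 : EuclideanSpace ℝ (Fin 3)) ∈ {x : EuclideanSpace ℝ (Fin 3) |
          ⟪EuclideanSpace.single (0 : Fin 3) (1 : ℝ), x⟫ = 0} := by simp
      rw [h] at this
      simp at this
    rcases hp with rfl | rfl <;> rcases hp' with rfl | rfl
    · exact absurd rfl hne
    · exact key
    · exact key.symm
    · exact absurd rfl hne


/-- Every chamber lies in the open `(111)` bilayer slab of its label (`j = 0` window). -/
theorem cellOf_subset_slab (k : Fin 3 → ℤ) (m : Fin 4 → ℤ) :
    cellOf k m ⊆ {x : EuclideanSpace ℝ (Fin 3) | (2 * m 0 : ℝ) < ⟪intVec (normal4 0), Real.sqrt 2 • x⟫ ∧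
      ⟪intVec (normal4 0), Real.sqrt 2 • x⟫ < 2 * m 0 + 2} :=
  fun x hx => ((mem_cellOf_iff k m x).1 hx).2 0

/-! ## The pieces -/

/-- **The super-level set as a union of open polytope pieces** (generic level).  Given the labelled
cells `lab j`, the affine data `(g j, b j)` of the tent on their closed chambers, a level `t` whose level
planes avoid the chamber facet planes, and `{f_X > t} ⊆ ⋃ closure (cells)`: unit-normal H-data `Hd j`
with pairwise distinct facet planes whose open polytopes are pairwise disjoint, lie in their cells and in
`{f_X > t}`, and exhaust `{f_X > t}` up to a null set. -/
theorem exists_polytope_pieces (X : Finset Site) {N : ℕ} (lab : Fin N → (Fin 3 → ℤ) × (Fin 4 → ℤ))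
    (hinj : Function.Injective lab) (g : Fin N → EuclideanSpace ℝ (Fin 3)) (b : Fin N → ℝ)
    (hgb : ∀ j, ∀ x ∈ closedChamber (lab j).1 (lab j).2, tent X x = ⟪g j, x⟫ + b j) (t : ℝ)
    (hgen : ∀ j, g j ≠ 0 → ∀ p ∈ chamberH (lab j).1 (lab j).2,
      {x : EuclideanSpace ℝ (Fin 3) | ⟪g j, x⟫ + b j = t} ≠ {x | ⟪p.1, x⟫ = p.2})
    (hcov : {x | t < tent X x} ⊆ ⋃ j, closure (cellOf (lab j).1 (lab j).2)) :
    ∃ Hd : Fin N → Finset (EuclideanSpace ℝ (Fin 3) × ℝ),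
      (∀ j, Bornology.IsBounded (polytope (Hd j))) ∧ (∀ j, ∀ p ∈ Hd j, ‖p.1‖ = 1) ∧
      (∀ j, ∀ p ∈ Hd j, ∀ p' ∈ Hd j, p ≠ p' →
        {x : EuclideanSpace ℝ (Fin 3) | ⟪p.1, x⟫ = p.2} ≠ {x | ⟪p'.1, x⟫ = p'.2}) ∧
      (∀ j j', j ≠ j' → Disjoint (polytope (Hd j)) (polytope (Hd j'))) ∧
      (∀ j, polytope (Hd j) ⊆ cellOf (lab j).1 (lab j).2) ∧
      (⋃ j, polytope (Hd j)) ⊆ {x | t < tent X x} ∧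
      volume ({x | t < tent X x} \ ⋃ j, polytope (Hd j)) = 0 := by
  classical
  -- the three kinds of pieces
  let nm : EuclideanSpace ℝ (Fin 3) × ℝ → EuclideanSpace ℝ (Fin 3) × ℝ := fun p => (‖p.1‖⁻¹ • p.1, ‖p.1‖⁻¹ * p.2)
  let E : Finset (EuclideanSpace ℝ (Fin 3) × ℝ) :=
    {(EuclideanSpace.single (0 : Fin 3) (1 : ℝ), (0 : ℝ)), (-EuclideanSpace.single (0 : Fin 3) (1 : ℝ), (-1 : ℝ))}
  let Hd : Fin N → Finset (EuclideanSpace ℝ (Fin 3) × ℝ) := fun j =>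
    if g j ≠ 0 then (insert (-g j, b j - t) (chamberH (lab j).1 (lab j).2)).image nm
    else if t < b j then (chamberH (lab j).1 (lab j).2).image nm else E
  obtain ⟨hE1, hE2, hE3⟩ := emptyPiece_spec
  -- nonzero normals and distinct planes of the inserted family
  have h0ins : ∀ j, g j ≠ 0 → ∀ p ∈ insert (-g j, b j - t) (chamberH (lab j).1 (lab j).2), p.1 ≠ 0 := by
    intro j hg p hp
    rcases Finset.mem_insert.1 hp with rfl | hp
    · simpa using hg
    · exact chamberH_fst_ne_zero hp
  have h0ch : ∀ j, ∀ p ∈ chamberH (lab j).1 (lab j).2, p.1 ≠ 0 := fun j p hp => chamberH_fst_ne_zero hp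
  have hlevel : ∀ j, {x : EuclideanSpace ℝ (Fin 3) | ⟪-g j, x⟫ = b j - t} = {x | ⟪g j, x⟫ + b j = t} := by
    intro j; ext x; simp only [Set.mem_setOf_eq, inner_neg_left]; constructor <;> intro h <;> linarith
  have hdist_ins : ∀ j, g j ≠ 0 → ∀ p ∈ insert (-g j, b j - t) (chamberH (lab j).1 (lab j).2),
      ∀ q ∈ insert (-g j, b j - t) (chamberH (lab j).1 (lab j).2), p ≠ q →
      {x : EuclideanSpace ℝ (Fin 3) | ⟪p.1, x⟫ = p.2} ≠ {x | ⟪q.1, x⟫ = q.2} := by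
    intro j hg p hp q hq hpq
    rcases Finset.mem_insert.1 hp with rfl | hp <;> rcases Finset.mem_insert.1 hq with rfl | hq
    · exact absurd rfl hpq
    · rw [hlevel]; exact hgen j hg q hq
    · rw [hlevel]; exact (hgen j hg p hp).symm
    · exact pairwise_plane_ne_chamberH _ _ hp hq hpq
  have hdist_ch : ∀ j, ∀ p ∈ chamberH (lab j).1 (lab j).2, ∀ q ∈ chamberH (lab j).1 (lab j).2, p ≠ q →
      {x : EuclideanSpace ℝ (Fin 3) | ⟪p.1, x⟫ = p.2} ≠ {x | ⟪q.1, x⟫ = q.2} :=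
    fun j p hp q hq hpq => pairwise_plane_ne_chamberH _ _ hp hq hpq
  -- the polytope of each kind
  have hpolyA : ∀ j, g j ≠ 0 → polytope (Hd j) = cellOf (lab j).1 (lab j).2 ∩ {x | t < ⟪g j, x⟫ + b j} := by
    intro j hg
    simp only [Hd, if_pos hg]
    rw [polytope_image_normalize _ (h0ins j hg), polytope, Finset.set_biInter_insert]
    ext x
    simp only [Set.mem_inter_iff, Set.mem_setOf_eq, inner_neg_left, cellOf]
    constructor
    · rintro ⟨h1, h2⟩; exact ⟨h2, by linarith⟩
    · rintro ⟨h1, h2⟩; exact ⟨by linarith, h1⟩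
  have hpolyB : ∀ j, ¬ g j ≠ 0 → t < b j → polytope (Hd j) = cellOf (lab j).1 (lab j).2 := by
    intro j hg hb
    simp only [Hd, if_neg hg, if_pos hb]
    rw [polytope_image_normalize _ (h0ch j)]; rfl
  have hpolyC : ∀ j, ¬ g j ≠ 0 → ¬ t < b j → polytope (Hd j) = ∅ := by
    intro j hg hb
    simp only [Hd, if_neg hg, if_neg hb]; exact hE1
  -- pieces lie in their cells
  have hsub : ∀ j, polytope (Hd j) ⊆ cellOf (lab j).1 (lab j).2 := by
    intro j
    by_cases hg : g j ≠ 0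
    · rw [hpolyA j hg]; exact Set.inter_subset_left
    · by_cases hb : t < b j
      · rw [hpolyB j hg hb]
      · rw [hpolyC j hg hb]; exact Set.empty_subset _
  refine ⟨Hd, fun j => (isBounded_cellOf _ _).subset (hsub j), ?_, ?_, ?_, hsub, ?_, ?_⟩
  · -- unit normals
    intro j p hp
    by_cases hg : g j ≠ 0
    · simp only [Hd, if_pos hg] at hp; exact norm_fst_of_mem_image_normalize (h0ins j hg) hp
    · by_cases hb : t < b j
      · simp only [Hd, if_neg hg, if_pos hb] at hp; exact norm_fst_of_mem_image_normalize (h0ch j) hp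
      · simp only [Hd, if_neg hg, if_neg hb] at hp; exact hE2 p hp
  · -- distinct planes
    intro j p hp p' hp' hne
    by_cases hg : g j ≠ 0
    · simp only [Hd, if_pos hg] at hp hp'
      exact plane_ne_of_mem_image_normalize (h0ins j hg) (hdist_ins j hg) hp hp' hne
    · by_cases hb : t < b j
      · simp only [Hd, if_neg hg, if_pos hb] at hp hp'
        exact plane_ne_of_mem_image_normalize (h0ch j) (hdist_ch j) hp hp' hne
      · simp only [Hd, if_neg hg, if_neg hb] at hp hp'; exact hE3 p hp p' hp' hne
  · -- disjoint
    intro j j' hjj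
    refine Set.disjoint_of_subset (hsub j) (hsub j') (disjoint_cellOf fun h => hjj (hinj ?_))
    exact Prod.ext (congrArg Prod.fst h) (congrArg Prod.snd h)
  · -- inside the super-level set
    intro x hx
    obtain ⟨j, hxj⟩ := Set.mem_iUnion.1 hx
    show t < tent X x
    by_cases hg : g j ≠ 0
    · rw [hpolyA j hg] at hxj
      rw [hgb j x (cellOf_subset_closedChamber _ _ hxj.1)]; exact hxj.2
    · by_cases hb : t < b j
      · rw [hpolyB j hg hb] at hxj
        push Not at hg
        rw [hgb j x (cellOf_subset_closedChamber _ _ hxj), hg, inner_zero_left, zero_add]; exact hb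
      · rw [hpolyC j hg hb] at hxj; exact absurd hxj (Set.notMem_empty _)
  · -- the difference lies in the cell boundaries
    have hfr : {x | t < tent X x} \ (⋃ j, polytope (Hd j)) ⊆ ⋃ j, frontier (cellOf (lab j).1 (lab j).2) := by
      rintro x ⟨hx, hxU⟩
      obtain ⟨j, hxj⟩ := Set.mem_iUnion.1 (hcov hx)
      refine Set.mem_iUnion.2 ⟨j, ?_⟩
      rw [frontier, (isOpen_cellOf _ _).interior_eq]
      refine ⟨hxj, fun hxQ => hxU (Set.mem_iUnion.2 ⟨j, ?_⟩)⟩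
      have htx : t < tent X x := hx
      by_cases hg : g j ≠ 0
      · rw [hpolyA j hg]
        refine ⟨hxQ, ?_⟩
        show t < ⟪g j, x⟫ + b j
        rw [← hgb j x (cellOf_subset_closedChamber _ _ hxQ)]; exact htx
      · by_cases hb : t < b j
        · rw [hpolyB j hg hb]; exact hxQ
        · exfalso
          push Not at hg
          rw [hgb j x (cellOf_subset_closedChamber _ _ hxQ), hg, inner_zero_left, zero_add] at htx
          exact hb htx
    refine measure_mono_null hfr ?_
    exact (measure_iUnion_null_iff).2 fun j => (convex_cellOf' (lab j).1 (lab j).2).addHaar_frontier volume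


end Summit.Ventures.Crystal3D.TentCertificate

end
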